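import Summits.CriticalPhenomena.PercolationContinuityZ3.Theorems.PercNearOneGluingNoHeavyConstsMDLXJointMarkerLattice
import HarnessLib

/-!
# MDL(X)′ for the van den Berg–Häggström–Kahn class, case J2, on the lattice of the AVOIDED cluster's marker events
# (PAPER-2 track (ii): constants of the CSH family; seat `prim-consts-2`, gen 12)

builds on p205010 (kernel theorem, internal audit signed; external expert review pending).  Support file (`--supports
stmt-CriticalPhenomena-4575`); memo `run/shared/lean/prim/consts/FROM-prim-consts-2-g12-EDGE-GIBBS.md` §1.  No definitions, no named facts,
no sorries.  Companion of `…ConstsMDLXJointMarkerLattice.lean` (the OWNER-side marker lattice) and `…ConstsMDLXJointTwoOneClass.lean`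
(`Consts.mdlxJoint_J2`: `Consts.MDLXJoint` ⟹ J2).

Notation: owner `s`, avoided set `X`, markers `y, z`; `D = {s ↮ X}`, `𝒜 = {y ↮ {s}∪X}`, `T = 𝒜 ∩ D`, `W = {y ↔ z}`, `Y = {s ↔ y}`, `Z = {s ↔ z}`,
`ν = μ(·|D)`, `p' = μ(T∩W)/μ(T)`; `A_y = {y ↮ X}`, `A_z = {z ↮ X}` (the markers are NOT swallowed by the avoided cluster `C_X`; both are
DECREASING functionals of `C_X`), `G_y = D ∩ {y ↔ X}`, `G_z = D ∩ {z ↔ X}`.  "J2" (memos g9 §0(3), g10 §3, g11 §0(5)) is the case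
`f = g(C_X)`, `g` antitone, of the Thm-2.1-class form of MDL(X)′:  `μ(T∩W)·cov_D(g(C_X); s↔y) ≤ μ(T)·cov_D(g(C_X); s↔z)`,
`cov_D(g; E) = μ(D)∫_{D∩E} g − (∫_D g)·μ(D∩E)`.  It is implied by `Consts.MDLXJoint` (`Consts.mdlxJoint_J2`) and was open at every
non-trivial `g`.  THIS FILE and its companion prove it, unconditionally, at the four non-trivial antitone indicators of the lattice `{0,1}²` of the avoided marker
pair `(1{y ∈ V(C_X)}, 1{z ∈ V(C_X)})`:

* `Consts.mdlxJ2_at_yAvoid` — `g = 1{y ↮ X}`:  `μ(T∩W)·[μ(D)μ(D∩A_y∩Y) − μ(D∩A_y)μ(D∩Y)] ≤ μ(T)·[μ(D)μ(D∩A_y∩Z) − μ(D∩A_y)μ(D∩Z)]`,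
  i.e. **`P(s↔z | s↮X) − P(s↔z | s↮X, y↔X) ≥ p'·P(s↔y | s↮X)`** ("the worlds in which `X` swallows `y` lose at `z` at least `p'` times the
  whole of `Y`").  Proof: with `E₁ = {{s,y} ↮ X} = T ⊔ (D∩Y)` and `G = G_y`, `RHS − LHS = (t + μ(D∩Y))·R' + g·Q'` where
  `R' = μ(G)μ(T∩Z) − μ(T)μ(G∩Z) ≥ 0` is van den Berg–Häggström–Kahn's Theorem 1.4 with sets (`{s}` repelled from `X ∪ {y}`; tree
  `Consts.swallow_reach_le`) and `Q' = μ(T)μ(D∩Y∩Z) − μ(D∩Y)(μ(T∩Z) + μ(T∩W)) ≥ 0` is their Theorem 1.3 with sets (source `{s,y}` repelled from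
  `X`, increasing functionals `1{s↔y}`, `1{z ∈ V(C_{{s,y}})}`) — the same two brackets as the owner-side marker theorem
  `Consts.mdlxJoint_connIndicator`, combined differently.
* `Consts.mdlxJ2_at_zAvoid` — `g = 1{z ↮ X}`: reduces to `ν(s↔z) ≥ p'·ν(s↔y)` (`Consts.mdlx_marker_reach_le`), since `D ∩ Z ⊆ A_z`.
* (companion file `…ConstsMDLXJointAvoidedMarkerLattice.lean`: `Consts.mdlxJ2_at_yzAvoid` — `g = 1{y ↮ X}·1{z ↮ X}`, and
  `Consts.mdlxJ2_at_yOrZAvoid` — `g = 1{y ↮ X ∨ z ↮ X}`; both corollaries of this file and `Consts.mdlx_marker_reach_le`.)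
Since J2 is linear in `g` and every antitone function of the pair is a nonnegative combination of these four indicators plus a constant,
**J2 holds for every functional of `C_X` that depends only on whether `y` and `z` are swallowed by the avoided cluster** — the mirror image
of the owner-side marker lattice (`Consts.mdlxJoint_of_markerMeasurable`).  The general J2 (e.g. `g = 1{u ↮ X}` for a fifth vertex `u`,
the `R2` of the cylinder split) remains open.
[cite: VandenbergHaggstromKahn2005, Thm. 1.3 (p. 6), Thm. 1.4 (p. 7) with Remark 1 after Thm. 1.2 (p. 5); Thm. 2.1 (p. 9)]
-/

noncomputable section

namespace Summit.CriticalPhenomena.PercolationContinuityZ3.Theorems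

open MeasureTheory Set Literature.Probability.LatticeModels Literature.Probability.Percolation
open scoped Classical

namespace Consts

variable {V : Type*} [Fintype V]

/-- **J2 at `g = 1{y ↮ X}`** (the avoided cluster does not swallow the marker `y`), measure form:
`μ(T∩W)·[μ(D)μ(D∩A_y∩Y) − μ(D∩A_y)μ(D∩Y)] ≤ μ(T)·[μ(D)μ(D∩A_y∩Z) − μ(D∩A_y)μ(D∩Z)]`, `A_y = {y ↮ X}`; equivalently
`P(s↔z | s↮X) − P(s↔z | s↮X, y↔X) ≥ p'·P(s↔y | s↮X)`.  From BHK Thm 1.3 with sets (source `{s,y}` repelled from `X`) and Thm 1.4 with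
sets (`{s}` vs `X ∪ {y}`). [cite: VandenbergHaggstromKahn2005, Thm. 1.3 (p. 6), Thm. 1.4 (p. 7), Remark 1 (p. 5)] -/
theorem mdlxJ2_at_yAvoid (w : Sym2 V → unitInterval) (s y z : V) (X : Set V) :
    (prodBernoulli w).real ({ω : BondConfig V | ∀ x ∈ insert s X, ¬ (openGraph ω).Reachable y x} ∩
        {ω | ∀ x ∈ X, ¬ (openGraph ω).Reachable s x} ∩ openConn y z) *
      ((prodBernoulli w).real {ω : BondConfig V | ∀ x ∈ X, ¬ (openGraph ω).Reachable s x} *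
          (prodBernoulli w).real ({ω : BondConfig V | ∀ x ∈ X, ¬ (openGraph ω).Reachable s x} ∩
            {ω | ∀ x ∈ X, ¬ (openGraph ω).Reachable y x} ∩ openConn s y) -
        (prodBernoulli w).real ({ω : BondConfig V | ∀ x ∈ X, ¬ (openGraph ω).Reachable s x} ∩
            {ω | ∀ x ∈ X, ¬ (openGraph ω).Reachable y x}) *
          (prodBernoulli w).real ({ω : BondConfig V | ∀ x ∈ X, ¬ (openGraph ω).Reachable s x} ∩ openConn s y)) ≤
    (prodBernoulli w).real ({ω : BondConfig V | ∀ x ∈ insert s X, ¬ (openGraph ω).Reachable y x} ∩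
        {ω | ∀ x ∈ X, ¬ (openGraph ω).Reachable s x}) *
      ((prodBernoulli w).real {ω : BondConfig V | ∀ x ∈ X, ¬ (openGraph ω).Reachable s x} *
          (prodBernoulli w).real ({ω : BondConfig V | ∀ x ∈ X, ¬ (openGraph ω).Reachable s x} ∩
            {ω | ∀ x ∈ X, ¬ (openGraph ω).Reachable y x} ∩ openConn s z) -
        (prodBernoulli w).real ({ω : BondConfig V | ∀ x ∈ X, ¬ (openGraph ω).Reachable s x} ∩
            {ω | ∀ x ∈ X, ¬ (openGraph ω).Reachable y x}) *
          (prodBernoulli w).real ({ω : BondConfig V | ∀ x ∈ X, ¬ (openGraph ω).Reachable s x} ∩ openConn s z)) := by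
  classical
  set μ := prodBernoulli w with hμ
  have hmeas : ∀ S : Set (BondConfig V), MeasurableSet S := fun _ => MeasurableSet.of_discrete
  set D : Set (BondConfig V) := {ω | ∀ x ∈ X, ¬ (openGraph ω).Reachable s x} with hD
  set A : Set (BondConfig V) := {ω | ∀ x ∈ insert s X, ¬ (openGraph ω).Reachable y x} with hA
  set Ay : Set (BondConfig V) := {ω | ∀ x ∈ X, ¬ (openGraph ω).Reachable y x} with hAy
  set Yv : Set (BondConfig V) := openConn s y with hYv
  set Zv : Set (BondConfig V) := openConn s z with hZv
  set Wv : Set (BondConfig V) := openConn y z with hWv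
  -- auxiliary events
  set E₁ : Set (BondConfig V) := {ω | ∀ a ∈ ({s, y} : Set V), ∀ x ∈ X, ¬ (openGraph ω).Reachable a x} with hE₁
  set E₂ : Set (BondConfig V) := {ω | ∀ a ∈ ({s} : Set V), ∀ x ∈ insert y X, ¬ (openGraph ω).Reachable a x} with hE₂
  set Gy : Set (BondConfig V) := {ω | ∃ x ∈ X, (openGraph ω).Reachable y x} with hGy
  set T : Set (BondConfig V) := A ∩ D with hT
  set G : Set (BondConfig V) := D ∩ Gy with hG
  -- elementary membership facts
  have mD : ∀ ω, ω ∈ D ↔ ∀ x ∈ X, ¬ (openGraph ω).Reachable s x := fun ω => Iff.rfl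
  have mA : ∀ ω, ω ∈ A ↔ ¬ (openGraph ω).Reachable y s ∧ ∀ x ∈ X, ¬ (openGraph ω).Reachable y x := by
    intro ω; simp only [hA, mem_setOf_eq, mem_insert_iff, forall_eq_or_imp]
  have mAy : ∀ ω, ω ∈ Ay ↔ ∀ x ∈ X, ¬ (openGraph ω).Reachable y x := fun ω => Iff.rfl
  have mE₁ : ∀ ω, ω ∈ E₁ ↔ (∀ x ∈ X, ¬ (openGraph ω).Reachable s x) ∧ ∀ x ∈ X, ¬ (openGraph ω).Reachable y x := by
    intro ω; simp only [hE₁, mem_setOf_eq, mem_insert_iff, mem_singleton_iff, forall_eq_or_imp, forall_eq]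
  have mE₂ : ∀ ω, ω ∈ E₂ ↔ ¬ (openGraph ω).Reachable s y ∧ ∀ x ∈ X, ¬ (openGraph ω).Reachable s x := by
    intro ω; simp only [hE₂, mem_setOf_eq, mem_singleton_iff, forall_eq, mem_insert_iff, forall_eq_or_imp]
  have mY : ∀ ω, ω ∈ Yv ↔ (openGraph ω).Reachable s y := fun ω => Iff.rfl
  have mZ : ∀ ω, ω ∈ Zv ↔ (openGraph ω).Reachable s z := fun ω => Iff.rfl
  have mW : ∀ ω, ω ∈ Wv ↔ (openGraph ω).Reachable y z := fun ω => Iff.rfl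
  have mGy : ∀ ω, ω ∈ Gy ↔ ∃ x ∈ X, (openGraph ω).Reachable y x := fun ω => Iff.rfl
  -- set identities
  have sDAy : D ∩ Ay = E₁ := by
    ext ω; simp only [mem_inter_iff, mD, mAy, mE₁]
  have sDE : D = E₁ ∪ G := by
    ext ω; simp only [mem_union, hG, mem_inter_iff, mE₁, mD, mGy]
    constructor
    · intro h
      by_cases hyx : ∃ x ∈ X, (openGraph ω).Reachable y x
      · exact Or.inr ⟨h, hyx⟩
      · simp only [not_exists, not_and] at hyx; exact Or.inl ⟨h, hyx⟩
    · rintro (⟨h, -⟩ | ⟨h, -⟩) <;> exact h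
  have dDE : Disjoint E₁ G := by
    rw [Set.disjoint_left]; intro ω h1 h2
    obtain ⟨x, hx, hr⟩ := (mem_inter_iff _ _ _).1 h2 |>.2
    exact ((mE₁ ω).1 h1).2 x hx hr
  have sDY : D ∩ Yv = E₁ ∩ Yv := by
    ext ω; simp only [mem_inter_iff, mE₁, mD, mY]
    constructor
    · rintro ⟨h, hsy⟩; exact ⟨⟨h, fun x hx hr => h x hx (hsy.trans hr)⟩, hsy⟩
    · rintro ⟨⟨h, -⟩, hsy⟩; exact ⟨h, hsy⟩
  have sDZ : D ∩ Zv = E₁ ∩ Zv ∪ G ∩ Zv := by rw [sDE, union_inter_distrib_right]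
  have dDZ : Disjoint (E₁ ∩ Zv) (G ∩ Zv) := dDE.mono inter_subset_left inter_subset_left
  have sT : T = E₁ ∩ Yvᶜ := by
    ext ω; simp only [hT, mem_inter_iff, mA, mD, mE₁, mem_compl_iff, mY]
    constructor
    · rintro ⟨⟨hys, hyX⟩, hsX⟩; exact ⟨⟨hsX, hyX⟩, fun h => hys h.symm⟩
    · rintro ⟨⟨hsX, hyX⟩, hsy⟩; exact ⟨⟨fun h => hsy h.symm, hyX⟩, hsX⟩
  have sE₁ : E₁ = T ∪ E₁ ∩ Yv := by
    rw [sT, ← inter_union_distrib_left, compl_union_self, inter_univ]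
  have dE₁ : Disjoint T (E₁ ∩ Yv) := by
    rw [sT]; exact Disjoint.mono inter_subset_right inter_subset_right disjoint_compl_left
  have sE₁Z : E₁ ∩ Zv = T ∩ Zv ∪ E₁ ∩ Yv ∩ Zv := by
    conv_lhs => rw [sE₁]
    rw [union_inter_distrib_right]
  have dE₁Z : Disjoint (T ∩ Zv) (E₁ ∩ Yv ∩ Zv) := dE₁.mono inter_subset_left inter_subset_left
  have sDN : D ∩ Yvᶜ = T ∪ G := by
    ext ω; simp only [mem_inter_iff, mem_compl_iff, mem_union, sT, hG, mE₁, mD, mY, mGy]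
    constructor
    · rintro ⟨hsX, hsy⟩
      by_cases hyx : ∃ x ∈ X, (openGraph ω).Reachable y x
      · exact Or.inr ⟨hsX, hyx⟩
      · simp only [not_exists, not_and] at hyx; exact Or.inl ⟨⟨hsX, hyx⟩, hsy⟩
    · rintro (⟨⟨hsX, -⟩, hsy⟩ | ⟨hsX, ⟨x, hx, hr⟩⟩)
      · exact ⟨hsX, hsy⟩
      · exact ⟨hsX, fun hsy => hsX x hx (hsy.trans hr)⟩
  have dDN : Disjoint T G := by
    rw [sT]; exact dDE.mono inter_subset_left le_rfl
  -- (Q) BHK Theorem 1.3 with sets: source `{s, y}` repelled from `X`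
  set F₁ : Set (Sym2 V) → ℝ := fun C => if (openGraph C).Reachable s y then 1 else 0 with hF₁
  set G₁ : Set (Sym2 V) → ℝ := fun C => if (openGraph C).Reachable s z ∨ (openGraph C).Reachable y z then 1 else 0 with hG₁
  have hF₁m : Monotone F₁ := by
    intro C C' h; simp only [hF₁]
    by_cases hc : (openGraph C).Reachable s y
    · rw [if_pos hc, if_pos (hc.mono (openGraph_mono h))]
    · rw [if_neg hc]; split_ifs <;> norm_num
  have hG₁m : Monotone G₁ := by
    intro C C' h; simp only [hG₁]
    by_cases hc : (openGraph C).Reachable s z ∨ (openGraph C).Reachable y z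
    · rw [if_pos hc, if_pos (hc.imp (fun hr => hr.mono (openGraph_mono h)) (fun hr => hr.mono (openGraph_mono h)))]
    · rw [if_neg hc]; split_ifs <;> norm_num
  have hF₁ω : ∀ ω : BondConfig V, F₁ (⋃ a ∈ ({s, y} : Set V), openEdgeCluster ω a) = Yv.indicator 1 ω := by
    intro ω
    have e := (KNSep.reachable_iff_cluster ω ({s, y} : Set V) (mem_insert s {y}) y).symm
    simp only [hF₁, e]
    by_cases h : (openGraph ω).Reachable s y
    · rw [if_pos h, indicator_of_mem (show ω ∈ Yv from h), Pi.one_apply]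
    · rw [if_neg h, indicator_of_notMem (show ω ∉ Yv from h)]
  have hG₁ω : ∀ ω : BondConfig V, G₁ (⋃ a ∈ ({s, y} : Set V), openEdgeCluster ω a) = (Zv ∪ Wv).indicator 1 ω := by
    intro ω
    have e1 := (KNSep.reachable_iff_cluster ω ({s, y} : Set V) (mem_insert s {y}) z).symm
    have e2 := (KNSep.reachable_iff_cluster ω ({s, y} : Set V) (mem_insert_of_mem s (mem_singleton y)) z).symm
    simp only [hG₁, e1, e2]
    by_cases h : (openGraph ω).Reachable s z ∨ (openGraph ω).Reachable y z
    · rw [if_pos h, indicator_of_mem (show ω ∈ Zv ∪ Wv from h), Pi.one_apply]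
    · rw [if_neg h, indicator_of_notMem (show ω ∉ Zv ∪ Wv from h)]
  have hQ0 := BHK2006_setClusterConditionalPositiveAssociation w ({s, y} : Set V) X F₁ G₁ hF₁m hG₁m
  simp only [hF₁ω, hG₁ω] at hQ0
  change (∫ ω in E₁, Yv.indicator 1 ω ∂μ) * (∫ ω in E₁, (Zv ∪ Wv).indicator 1 ω ∂μ) ≤
    μ.real E₁ * ∫ ω in E₁, Yv.indicator 1 ω * (Zv ∪ Wv).indicator 1 ω ∂μ at hQ0
  rw [TripodExchange.setIntegral_indicator_one_eq, TripodExchange.setIntegral_indicator_one_eq,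
    TripodExchange.setIntegral_indicator_mul_indicator_eq] at hQ0
  -- hQ0 : μ(E₁ ∩ Yv) * μ(E₁ ∩ (Zv ∪ Wv)) ≤ μ E₁ * μ(E₁ ∩ (Yv ∩ (Zv ∪ Wv)))
  have sYZW : E₁ ∩ (Yv ∩ (Zv ∪ Wv)) = E₁ ∩ Yv ∩ Zv := by
    ext ω; simp only [mem_inter_iff, mem_union, mY, mZ, mW]
    constructor
    · rintro ⟨h1, hsy, hzw⟩
      exact ⟨⟨h1, hsy⟩, hzw.elim id fun hyz => hsy.trans hyz⟩
    · rintro ⟨⟨h1, hsy⟩, hsz⟩; exact ⟨h1, hsy, Or.inl hsz⟩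
  have sZW : E₁ ∩ (Zv ∪ Wv) = E₁ ∩ Zv ∪ T ∩ Wv := by
    ext ω; simp only [mem_inter_iff, mem_union, sT, mem_compl_iff, mY, mZ, mW]
    constructor
    · rintro ⟨h1, (hsz | hyz)⟩
      · exact Or.inl ⟨h1, hsz⟩
      · by_cases hsz : (openGraph ω).Reachable s z
        · exact Or.inl ⟨h1, hsz⟩
        · exact Or.inr ⟨⟨h1, fun hsy => hsz (hsy.trans hyz)⟩, hyz⟩
    · rintro (⟨h1, hsz⟩ | ⟨⟨h1, -⟩, hyz⟩)
      · exact ⟨h1, Or.inl hsz⟩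
      · exact ⟨h1, Or.inr hyz⟩
  have dZW : Disjoint (E₁ ∩ Zv) (T ∩ Wv) := by
    rw [Set.disjoint_left]
    rintro ω ⟨-, hsz⟩ ⟨hT', hyz⟩
    rw [sT] at hT'
    exact hT'.2 ((show (openGraph ω).Reachable s z from hsz).trans (show (openGraph ω).Reachable y z from hyz).symm)
  rw [sYZW, sZW, measureReal_union dZW (hmeas _)] at hQ0
  -- (R) BHK Theorem 1.4 with sets: `{s}` repelled from `X ∪ {y}`
  set G₂ : Set (Sym2 V) → ℝ := fun C => if ∃ x ∈ X, (openGraph C).Reachable y x then 1 else 0 with hG₂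
  have hG₂m : Monotone G₂ := by
    refine TripodExchange.predIndicator_monotone ?_
    rintro C C' hCC' ⟨x, hx, hr⟩
    exact ⟨x, hx, hr.mono (openGraph_mono hCC')⟩
  have hF₂ω : ∀ ω : BondConfig V, connIndicatorFn s z (⋃ a ∈ ({s} : Set V), openEdgeCluster ω a) = Zv.indicator 1 ω := by
    intro ω
    have : (⋃ a ∈ ({s} : Set V), openEdgeCluster ω a) = openEdgeCluster ω s := by ext e; simp
    rw [this, connIndicatorFn_openEdgeCluster]
  have hG₂ω : ∀ ω : BondConfig V, G₂ (⋃ t ∈ insert y X, openEdgeCluster ω t) = Gy.indicator 1 ω := by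
    intro ω
    have hiff : (∃ x ∈ X, (openGraph (⋃ t ∈ insert y X, openEdgeCluster ω t)).Reachable y x) ↔
        ∃ x ∈ X, (openGraph ω).Reachable y x := by
      constructor
      · rintro ⟨x, hx, hr⟩
        exact ⟨x, hx, (KNSep.reachable_iff_cluster ω (insert y X) (mem_insert y X) x).2 hr⟩
      · rintro ⟨x, hx, hr⟩
        exact ⟨x, hx, (KNSep.reachable_iff_cluster ω (insert y X) (mem_insert y X) x).1 hr⟩
    simp only [hG₂, hiff]
    exact TwoSetConditionalAssociation.predIndicator_eq_indicator (fun ω' => ∃ x ∈ X, (openGraph ω').Reachable y x) ω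
  have hR0 := BHK2006_twoSetConditionalAssociation.negCorrelation w ({s} : Set V) (insert y X) (connIndicatorFn s z) G₂
    (monotone_connIndicatorFn s z) hG₂m
  simp only [hF₂ω, hG₂ω] at hR0
  change μ.real E₂ * (∫ ω in E₂, Zv.indicator 1 ω * Gy.indicator 1 ω ∂μ) ≤
    (∫ ω in E₂, Zv.indicator 1 ω ∂μ) * ∫ ω in E₂, Gy.indicator 1 ω ∂μ at hR0
  rw [TripodExchange.setIntegral_indicator_one_eq, TripodExchange.setIntegral_indicator_one_eq,
    TripodExchange.setIntegral_indicator_mul_indicator_eq] at hR0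
  -- hR0 : μ E₂ * μ(E₂ ∩ (Zv ∩ Gy)) ≤ μ(E₂ ∩ Zv) * μ(E₂ ∩ Gy)
  have sE₂ : E₂ = T ∪ G := by
    rw [← sDN]
    ext ω; simp only [mE₂, mem_inter_iff, mD, mem_compl_iff, mY]; tauto
  have sE₂G : E₂ ∩ Gy = G := by
    ext ω; simp only [mem_inter_iff, mE₂, hG, mD, mGy]
    constructor
    · rintro ⟨⟨-, hsX⟩, hyx⟩; exact ⟨hsX, hyx⟩
    · rintro ⟨hsX, ⟨x, hx, hr⟩⟩; exact ⟨⟨fun hsy => hsX x hx (hsy.trans hr), hsX⟩, ⟨x, hx, hr⟩⟩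
  have sE₂ZG : E₂ ∩ (Zv ∩ Gy) = G ∩ Zv := by
    rw [inter_comm Zv Gy, ← inter_assoc, sE₂G]
  have sE₂Z : E₂ ∩ Zv = T ∩ Zv ∪ G ∩ Zv := by rw [sE₂, union_inter_distrib_right]
  have dTGZ : Disjoint (T ∩ Zv) (G ∩ Zv) := dDN.mono inter_subset_left inter_subset_left
  rw [sE₂ZG, sE₂Z, sE₂G, sE₂, measureReal_union dDN (hmeas _), measureReal_union dTGZ (hmeas _)] at hR0
  -- rewrite the goal in terms of the pieces
  have eE₁ : μ.real E₁ = μ.real T + μ.real (E₁ ∩ Yv) := by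
    rw [← measureReal_union dE₁ (hmeas _), ← sE₁]
  have eE₁Z : μ.real (E₁ ∩ Zv) = μ.real (T ∩ Zv) + μ.real (E₁ ∩ Yv ∩ Zv) := by
    rw [← measureReal_union dE₁Z (hmeas _), ← sE₁Z]
  have eD : μ.real D = μ.real T + μ.real (E₁ ∩ Yv) + μ.real G := by
    rw [sDE, measureReal_union dDE (hmeas _), eE₁]
  have eDZ : μ.real (D ∩ Zv) = μ.real (T ∩ Zv) + μ.real (E₁ ∩ Yv ∩ Zv) + μ.real (G ∩ Zv) := by
    rw [sDZ, measureReal_union dDZ (hmeas _), eE₁Z]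
  have sDAyY : D ∩ Ay ∩ Yv = E₁ ∩ Yv := by rw [sDAy]
  have sDAyZ : D ∩ Ay ∩ Zv = E₁ ∩ Zv := by rw [sDAy]
  have eADW : μ.real (A ∩ D ∩ Wv) = μ.real (T ∩ Wv) := rfl
  have eAD : μ.real (A ∩ D) = μ.real T := rfl
  change μ.real (A ∩ D ∩ Wv) * (μ.real D * μ.real (D ∩ Ay ∩ Yv) - μ.real (D ∩ Ay) * μ.real (D ∩ Yv)) ≤
    μ.real (A ∩ D) * (μ.real D * μ.real (D ∩ Ay ∩ Zv) - μ.real (D ∩ Ay) * μ.real (D ∩ Zv))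
  rw [eADW, eAD, sDAyY, sDAyZ, sDAy, sDY, eD, eDZ, eE₁, eE₁Z]
  rw [eE₁, eE₁Z] at hQ0
  -- the final combination `RHS − LHS = (t + μ(E₁∩Y))·R' + μ(G)·Q'`
  have h0 : ∀ S : Set (BondConfig V), 0 ≤ μ.real S := fun _ => measureReal_nonneg
  nlinarith [hQ0, hR0, h0 T, h0 G, h0 (E₁ ∩ Yv), h0 (T ∩ Zv), h0 (G ∩ Zv), h0 (E₁ ∩ Yv ∩ Zv), h0 (T ∩ Wv),
    mul_nonneg (add_nonneg (h0 T) (h0 (E₁ ∩ Yv))) (sub_nonneg.2 hR0), mul_nonneg (h0 G) (sub_nonneg.2 hQ0)]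

/-- **J2 at `g = 1{z ↮ X}`** (the avoided cluster does not swallow the target marker `z`), measure form:
`μ(T∩W)·[μ(D)μ(D∩A_z∩Y) − μ(D∩A_z)μ(D∩Y)] ≤ μ(T)·[μ(D)μ(D∩A_z∩Z) − μ(D∩A_z)μ(D∩Z)]`, `A_z = {z ↮ X}`.  Inside `D`, `Z ⊆ A_z`, so
both brackets are multiples of `μ(D ∩ {z↔X})` and the inequality is `ν(s↔z) ≥ p'ν(s↔y)` (`Consts.mdlx_marker_reach_le`) plus a nonnegative
term. [cite: VandenbergHaggstromKahn2005, Thm. 1.3 (p. 6), Thm. 1.4 (p. 7) — corollary, derived here] -/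
theorem mdlxJ2_at_zAvoid (w : Sym2 V → unitInterval) (s y z : V) (X : Set V) :
    (prodBernoulli w).real ({ω : BondConfig V | ∀ x ∈ insert s X, ¬ (openGraph ω).Reachable y x} ∩
        {ω | ∀ x ∈ X, ¬ (openGraph ω).Reachable s x} ∩ openConn y z) *
      ((prodBernoulli w).real {ω : BondConfig V | ∀ x ∈ X, ¬ (openGraph ω).Reachable s x} *
          (prodBernoulli w).real ({ω : BondConfig V | ∀ x ∈ X, ¬ (openGraph ω).Reachable s x} ∩
            {ω | ∀ x ∈ X, ¬ (openGraph ω).Reachable z x} ∩ openConn s y) -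
        (prodBernoulli w).real ({ω : BondConfig V | ∀ x ∈ X, ¬ (openGraph ω).Reachable s x} ∩
            {ω | ∀ x ∈ X, ¬ (openGraph ω).Reachable z x}) *
          (prodBernoulli w).real ({ω : BondConfig V | ∀ x ∈ X, ¬ (openGraph ω).Reachable s x} ∩ openConn s y)) ≤
    (prodBernoulli w).real ({ω : BondConfig V | ∀ x ∈ insert s X, ¬ (openGraph ω).Reachable y x} ∩
        {ω | ∀ x ∈ X, ¬ (openGraph ω).Reachable s x}) *
      ((prodBernoulli w).real {ω : BondConfig V | ∀ x ∈ X, ¬ (openGraph ω).Reachable s x} *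
          (prodBernoulli w).real ({ω : BondConfig V | ∀ x ∈ X, ¬ (openGraph ω).Reachable s x} ∩
            {ω | ∀ x ∈ X, ¬ (openGraph ω).Reachable z x} ∩ openConn s z) -
        (prodBernoulli w).real ({ω : BondConfig V | ∀ x ∈ X, ¬ (openGraph ω).Reachable s x} ∩
            {ω | ∀ x ∈ X, ¬ (openGraph ω).Reachable z x}) *
          (prodBernoulli w).real ({ω : BondConfig V | ∀ x ∈ X, ¬ (openGraph ω).Reachable s x} ∩ openConn s z)) := by
  classical
  set μ := prodBernoulli w with hμ
  have hmeas : ∀ S : Set (BondConfig V), MeasurableSet S := fun _ => MeasurableSet.of_discrete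
  set D : Set (BondConfig V) := {ω | ∀ x ∈ X, ¬ (openGraph ω).Reachable s x} with hD
  set A : Set (BondConfig V) := {ω | ∀ x ∈ insert s X, ¬ (openGraph ω).Reachable y x} with hA
  set Az : Set (BondConfig V) := {ω | ∀ x ∈ X, ¬ (openGraph ω).Reachable z x} with hAz
  set Yv : Set (BondConfig V) := openConn s y with hYv
  set Zv : Set (BondConfig V) := openConn s z with hZv
  set Wv : Set (BondConfig V) := openConn y z with hWv
  set Gz : Set (BondConfig V) := D \ Az with hGz
  have key := mdlx_marker_reach_le w s y z X
  change μ.real (A ∩ D ∩ Wv) * μ.real (D ∩ Yv) ≤ μ.real (A ∩ D) * μ.real (D ∩ Zv) at key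
  have mD : ∀ ω, ω ∈ D ↔ ∀ x ∈ X, ¬ (openGraph ω).Reachable s x := fun ω => Iff.rfl
  have mAz : ∀ ω, ω ∈ Az ↔ ∀ x ∈ X, ¬ (openGraph ω).Reachable z x := fun ω => Iff.rfl
  -- `D = (D ∩ Az) ⊔ Gz`, `D ∩ Z ⊆ Az`
  have eDAz : μ.real (D ∩ Az) + μ.real Gz = μ.real D :=
    measureReal_inter_add_sdiff (μ := μ) (s := D) (hmeas Az)
  have sDAzZ : D ∩ Az ∩ Zv = D ∩ Zv := by
    ext ω; simp only [mem_inter_iff, mD, mAz]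
    constructor
    · rintro ⟨⟨hD', -⟩, hz⟩; exact ⟨hD', hz⟩
    · rintro ⟨hD', hz⟩
      exact ⟨⟨hD', fun x hx hr => hD' x hx ((show (openGraph ω).Reachable s z from hz).trans hr)⟩, hz⟩
  have eDAzY : μ.real (D ∩ Az ∩ Yv) + μ.real (Gz ∩ Yv) = μ.real (D ∩ Yv) := by
    have h := measureReal_inter_add_sdiff (μ := μ) (s := D ∩ Yv) (hmeas Az)
    have e1 : D ∩ Yv ∩ Az = D ∩ Az ∩ Yv := inter_right_comm D Yv Az
    have e2 : (D ∩ Yv) \ Az = Gz ∩ Yv := by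
      ext ω; simp only [hGz, mem_sdiff, mem_inter_iff]; tauto
    rwa [e1, e2] at h
  rw [sDAzZ]
  have h0 : ∀ S : Set (BondConfig V), 0 ≤ μ.real S := fun _ => measureReal_nonneg
  have e1 : μ.real D * μ.real (D ∩ Az ∩ Yv) - μ.real (D ∩ Az) * μ.real (D ∩ Yv) =
      μ.real Gz * μ.real (D ∩ Yv) - μ.real D * μ.real (Gz ∩ Yv) := by
    rw [← eDAz, ← eDAzY]; ring
  have e2 : μ.real D * μ.real (D ∩ Zv) - μ.real (D ∩ Az) * μ.real (D ∩ Zv) = μ.real Gz * μ.real (D ∩ Zv) := by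
    rw [← eDAz]; ring
  rw [e1, e2]
  have hA := mul_le_mul_of_nonneg_left key (h0 Gz)
  have hB := mul_nonneg (h0 (A ∩ D ∩ Wv)) (mul_nonneg (h0 D) (h0 (Gz ∩ Yv)))
  calc μ.real (A ∩ D ∩ Wv) * (μ.real Gz * μ.real (D ∩ Yv) - μ.real D * μ.real (Gz ∩ Yv))
        = μ.real Gz * (μ.real (A ∩ D ∩ Wv) * μ.real (D ∩ Yv)) - μ.real (A ∩ D ∩ Wv) * (μ.real D * μ.real (Gz ∩ Yv)) := by
          ring
    _ ≤ μ.real Gz * (μ.real (A ∩ D) * μ.real (D ∩ Zv)) - 0 := by linarith [hA, hB]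
    _ = μ.real (A ∩ D) * (μ.real Gz * μ.real (D ∩ Zv)) := by ring

end Consts

end Summit.CriticalPhenomena.PercolationContinuityZ3.Theorems

end
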